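import Mathlib
import Summits.Ventures.PercRepro2.Defs

/-!
# Disagreement sums: the pinning recursion behind two-copy (line-convexity) inequalities
(blind cell PercRepro2, p1; `proofs/P1-TWOCOPY.md` §2)

For a kernel `K : Config E → Config E → R` and a set `F` of edges, the **disagreement sum** is

  `disSum p F K = ∑_{x, y : x e ≠ y e ∀ e ∈ F} weight p x · weight p y · K x y`.

* `F = ∅` is the bilinear form `∑_{x,y} P(x) P(y) K(x,y)` of a one-copy inequality
  (for the cross-cluster BHK kernel: twice the BHK slack `P(Q,oL)P(Q,bH) − P(Q)P(Q,oL,bH)`);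
* `F = {f}` is `p_f (1 − p_f)` times the **two-copy** (mixed) form of the same inequality along
  the edge line of `f` — the "polarisation" coefficient `2 B(v_d, v_c)`.

The whole file is the exploration primitive applied to both copies at once:

* `disSum_pin`: for every edge `e`,
  `disSum p F K = (1 − p e)² · disSum p[e↦0] F K + (p e)² · disSum p[e↦1] F K + disSum p (insert e F) K`
  (the diagonal states `(x e, y e) = (0,0), (1,1)` are the two pinned laws, the off-diagonal states
  are exactly the `insert e F`-disagreement sum);
* `disSum_nonneg_of_pinned`: if every disagreement sum whose free edges are all pinned
  (`p e ∈ {0, 1}` off `F`) is nonnegative, then every disagreement sum is — by induction on the number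
  of free fractional edges. The hypothesis is weight-free: with the edges off `F` pinned to `z`, the
  sum is `∏_{e ∈ F} p_e (1 − p_e)` times `∑_{x} K(x ∪ z, x̄ ∪ z)` over complementary pairs on `F`
  (`disSum_pinned_eq`), a counting statement about 2-colourings of the minor.

So a one-copy inequality AND all its multi-edge two-copy forms follow from the complementary-pair
counts on all minors (`proofs/P1-TWOCOPY.md` §2–3).
-/

namespace Summit.Ventures.PercRepro2

section DisSumDefs

variable {E : Type*} [Fintype E] [DecidableEq E] {R : Type*} [CommRing R]

/-- The disagreement sum `∑_{x, y : x e ≠ y e ∀ e ∈ F} weight p x · weight p y · K x y`. -/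
def disSum (p : E → R) (F : Finset E) (K : Config E → Config E → R) : R :=
  ∑ x : Config E, ∑ y : Config E,
    if ∀ e ∈ F, x e ≠ y e then weight p x * weight p y * K x y else 0

/-- The bilinear form of two (possibly different) product weights:
`∑_{x,y} weight q x · weight q' y · K x y`. -/
def biForm (q q' : E → R) (K : Config E → Config E → R) : R :=
  ∑ x : Config E, ∑ y : Config E, weight q x * weight q' y * K x y

/-- With no disagreement constraint the disagreement sum is the one-copy bilinear form. -/
lemma disSum_empty (p : E → R) (K : Config E → Config E → R) :
    disSum p ∅ K = biForm p p K := by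
  unfold disSum biForm
  simp

/-- Pointwise pinning identity for one pair of configurations. -/
lemma disSum_term_pin (p : E → R) (F : Finset E) (K : Config E → Config E → R) (e : E)
    (x y : Config E) :
    (if ∀ e' ∈ F, x e' ≠ y e' then weight p x * weight p y * K x y else 0) =
      (1 - p e) ^ 2 * (if ∀ e' ∈ F, x e' ≠ y e' then
          weight (Function.update p e 0) x * weight (Function.update p e 0) y * K x y else 0) +
        (p e) ^ 2 * (if ∀ e' ∈ F, x e' ≠ y e' then
          weight (Function.update p e 1) x * weight (Function.update p e 1) y * K x y else 0) +
        (if ∀ e' ∈ insert e F, x e' ≠ y e' then weight p x * weight p y * K x y else 0) := by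
  by_cases hF : ∀ e' ∈ F, x e' ≠ y e'
  · have hins : (∀ e' ∈ insert e F, x e' ≠ y e') ↔ x e ≠ y e := by
      rw [Finset.forall_mem_insert]
      exact and_iff_left hF
    have hite : ∀ a : R, (if ∀ e' ∈ F, x e' ≠ y e' then a else 0) = a := fun a => if_pos hF
    simp only [hite, hins]
    have hx := weight_eq_pin p x e
    have hy := weight_eq_pin p y e
    cases hxe : x e <;> cases hye : y e
    · rw [weight_update_one_of_eq_false p hxe] at hx ⊢
      rw [weight_update_one_of_eq_false p hye] at hy ⊢
      simp only [ne_eq, not_true_eq_false, if_false]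
      rw [hx, hy]
      ring
    · rw [weight_update_one_of_eq_false p hxe] at hx ⊢
      rw [weight_update_zero_of_eq_true p hye] at hy ⊢
      simp only [ne_eq, Bool.false_eq_true, not_false_eq_true, if_true]
      rw [hx, hy]
      ring
    · rw [weight_update_zero_of_eq_true p hxe] at hx ⊢
      rw [weight_update_one_of_eq_false p hye] at hy ⊢
      simp only [ne_eq, Bool.true_eq_false, not_false_eq_true, if_true]
      rw [hx, hy]
      ring
    · rw [weight_update_zero_of_eq_true p hxe] at hx ⊢
      rw [weight_update_zero_of_eq_true p hye] at hy ⊢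
      simp only [ne_eq, not_true_eq_false, if_false]
      rw [hx, hy]
      ring
  · have hins : ¬ ∀ e' ∈ insert e F, x e' ≠ y e' := by
      intro h
      exact hF fun e' he' => h e' (Finset.mem_insert_of_mem he')
    simp only [hF, hins, if_false, mul_zero, add_zero]

/-- **Pinning recursion for disagreement sums** (exploration of one edge in both copies): for every
edge `e`,
`disSum p F K = (1 − p e)² · disSum p[e↦0] F K + (p e)² · disSum p[e↦1] F K + disSum p (insert e F) K`.
-/
theorem disSum_pin (p : E → R) (F : Finset E) (K : Config E → Config E → R) (e : E) :
    disSum p F K = (1 - p e) ^ 2 * disSum (Function.update p e 0) F K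
      + (p e) ^ 2 * disSum (Function.update p e 1) F K + disSum p (insert e F) K := by
  unfold disSum
  simp only [Finset.mul_sum]
  rw [← Finset.sum_add_distrib, ← Finset.sum_add_distrib]
  refine Finset.sum_congr rfl fun x _ => ?_
  rw [← Finset.sum_add_distrib, ← Finset.sum_add_distrib]
  refine Finset.sum_congr rfl fun y _ => ?_
  exact disSum_term_pin p F K e x y

/-- The singleton disagreement sum is `p f (1 − p f)` times the symmetrised two-copy bilinear form
of the two pinned laws (`p[f↦1]`, `p[f↦0]`). -/
theorem disSum_singleton (p : E → R) (K : Config E → Config E → R) (f : E) :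
    disSum p {f} K = p f * (1 - p f) *
      (biForm (Function.update p f 1) (Function.update p f 0) K +
        biForm (Function.update p f 0) (Function.update p f 1) K) := by
  unfold disSum biForm
  rw [mul_add, Finset.mul_sum, Finset.mul_sum, ← Finset.sum_add_distrib]
  refine Finset.sum_congr rfl fun x _ => ?_
  rw [Finset.mul_sum, Finset.mul_sum, ← Finset.sum_add_distrib]
  refine Finset.sum_congr rfl fun y _ => ?_
  simp only [Finset.mem_singleton, forall_eq]
  have hx := weight_eq_pin p x f
  have hy := weight_eq_pin p y f
  cases hxf : x f <;> cases hyf : y f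
  · rw [weight_update_one_of_eq_false p hxf] at hx ⊢
    rw [weight_update_one_of_eq_false p hyf] at hy ⊢
    simp only [ne_eq, not_true_eq_false, if_false]
    ring
  · rw [weight_update_one_of_eq_false p hxf] at hx ⊢
    rw [weight_update_zero_of_eq_true p hyf] at hy ⊢
    simp only [ne_eq, Bool.false_eq_true, not_false_eq_true, if_true]
    rw [hx, hy]
    ring
  · rw [weight_update_zero_of_eq_true p hxf] at hx ⊢
    rw [weight_update_one_of_eq_false p hyf] at hy ⊢
    simp only [ne_eq, Bool.true_eq_false, not_false_eq_true, if_true]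
    rw [hx, hy]
    ring
  · rw [weight_update_zero_of_eq_true p hxf] at hx ⊢
    rw [weight_update_zero_of_eq_true p hyf] at hy ⊢
    simp only [ne_eq, not_true_eq_false, if_false]
    ring

end DisSumDefs

section FracFree

variable {E : Type*} [Fintype E] [DecidableEq E] {R : Type*} [CommRing R] [DecidableEq R]

/-- The free fractional edges of `(p, F)`: the edges off `F` whose weight is neither `0` nor `1`. -/
def fracFree (p : E → R) (F : Finset E) : Finset E :=
  Finset.univ.filter fun e => e ∉ F ∧ p e ≠ 0 ∧ p e ≠ 1

/-- Membership in the free fractional edges. -/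
lemma mem_fracFree {p : E → R} {F : Finset E} {e : E} :
    e ∈ fracFree p F ↔ e ∉ F ∧ p e ≠ 0 ∧ p e ≠ 1 := by
  simp [fracFree]

/-- Pinning `e` removes it from the free fractional edges. -/
lemma fracFree_update (p : E → R) (F : Finset E) (e : E) (c : R) (hc : c = 0 ∨ c = 1) :
    fracFree (Function.update p e c) F = (fracFree p F).erase e := by
  ext e'
  simp only [mem_fracFree, Finset.mem_erase]
  by_cases h : e' = e
  · subst h
    simp only [Function.update_self, ne_eq, not_true_eq_false, false_and, iff_false,
      not_and, not_not]
    intro _ h0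
    rcases hc with hc | hc
    · exact absurd hc h0
    · exact hc
  · simp [h]

/-- Adding `e` to `F` removes it from the free fractional edges. -/
lemma fracFree_insert (p : E → R) (F : Finset E) (e : E) :
    fracFree p (insert e F) = (fracFree p F).erase e := by
  ext e'
  simp only [mem_fracFree, Finset.mem_erase, Finset.mem_insert, not_or]
  tauto

end FracFree

section Reduction

variable {E : Type*} [Fintype E] [DecidableEq E] {R : Type*} [CommRing R] [LinearOrder R]
  [IsStrictOrderedRing R]

/-- **Reduction theorem.** If every disagreement sum whose free edges are all pinned
(`p e ∈ {0,1}` for `e ∉ F`) is nonnegative, then every disagreement sum is nonnegative, for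
every weight vector with values in `[0,1]`. Induction on the number of free fractional edges
through `disSum_pin`. -/
theorem disSum_nonneg_of_pinned (K : Config E → Config E → R)
    (hbase : ∀ (q : E → R) (G : Finset E), (∀ e, 0 ≤ q e ∧ q e ≤ 1) →
      (∀ e, e ∉ G → q e = 0 ∨ q e = 1) → 0 ≤ disSum q G K)
    (p : E → R) (hp : ∀ e, 0 ≤ p e ∧ p e ≤ 1) (F : Finset E) : 0 ≤ disSum p F K := by
  generalize hn : (fracFree p F).card = n
  induction n using Nat.strong_induction_on generalizing p F with
  | _ n ih =>
    by_cases h0 : fracFree p F = ∅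
    · apply hbase p F hp
      intro e he
      by_contra hc
      rw [not_or] at hc
      have : e ∈ fracFree p F := mem_fracFree.mpr ⟨he, hc.1, hc.2⟩
      rw [h0] at this
      exact absurd this (Finset.notMem_empty e)
    · obtain ⟨e, he⟩ := Finset.nonempty_iff_ne_empty.mpr h0
      have hlt : ((fracFree p F).erase e).card < n := by
        rw [← hn]
        exact Finset.card_erase_lt_of_mem he
      have hp0 : ∀ e', 0 ≤ Function.update p e 0 e' ∧ Function.update p e 0 e' ≤ 1 := by
        intro e'
        by_cases h : e' = e
        · subst h; simp
        · rw [Function.update_of_ne h]; exact hp e'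
      have hp1 : ∀ e', 0 ≤ Function.update p e 1 e' ∧ Function.update p e 1 e' ≤ 1 := by
        intro e'
        by_cases h : e' = e
        · subst h; simp
        · rw [Function.update_of_ne h]; exact hp e'
      have hc0 : (fracFree (Function.update p e 0) F).card = ((fracFree p F).erase e).card := by
        rw [fracFree_update p F e 0 (Or.inl rfl)]
      have hc1 : (fracFree (Function.update p e 1) F).card = ((fracFree p F).erase e).card := by
        rw [fracFree_update p F e 1 (Or.inr rfl)]
      have hc2 : (fracFree p (insert e F)).card = ((fracFree p F).erase e).card := by
        rw [fracFree_insert]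
      have h1 : 0 ≤ disSum (Function.update p e 0) F K := ih _ hlt _ hp0 F hc0
      have h2 : 0 ≤ disSum (Function.update p e 1) F K := ih _ hlt _ hp1 F hc1
      have h3 : 0 ≤ disSum p (insert e F) K := ih _ hlt _ hp (insert e F) hc2
      rw [disSum_pin p F K e]
      have hpe := hp e
      positivity

end Reduction

end Summit.Ventures.PercRepro2
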